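import Mathlib.FieldTheory.Galois.Profinite
import Mathlib.FieldTheory.IsAlgClosed.Basic
import Literature.AlgebraicGeometry.Frobenioids.QuasiTemperoidGaloisFields
import HarnessLib

/-!
# Frobenioids II, Example 1.3 (iii) / Example 1.1: `B^temp(G_F)⁰ → D₀` is an EQUIVALENCE
# (Grothendieck's Galois correspondence on connected objects) — proof-only sequel

Mochizuki, *The geometry of Frobenioids II*, Kyushu J. Math. **62** (2008) 401–460, §1, Example 1.3 (iii)
p. 12 "`D₀ = B^temp(G_{ℚ_p})⁰` [cf. Example 1.1, (ii)]" and Example 1.1 (i) p. 7 "`D₀` [is] the full subcategory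
of connected objects of the Galois category of finite étale coverings of `Spec(ℚ_p)`"
[cite: MochizukiFrdII2008, Ex 1.3 (iii) pp.11-12]: the print IDENTIFIES the two categories. The construction
file `QuasiTemperoidGaloisFields.lean` gives the functor `QuasiTemperoid.galoisFields F : B^temp(G_F)⁰ ⥤
FinEtale F` (`X ↦ Spec F̄^{Stab(x_X)}`) and its faithfulness. This PROOF-ONLY file (no definitions)
completes the identification for a perfect field `F`:

* `galoisFields_full` — FULL: an `F`-algebra map `φ : F̄^{Stab(x_Y)} → F̄^{Stab(x_X)}` extends to
  `σ ∈ Gal(F̄/F)` (Mathlib `AlgHom.liftNormal` + bijectivity of endomorphisms of an algebraic extension), and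
  `x_X ↦ σ·x_Y` extends to a `G_F`-map (maps out of a single orbit descend along `Stab(x_X) ⊆ σ Stab(x_Y) σ⁻¹`,
  which holds because `σ` carries `F̄^{Stab(x_Y)}` into `F̄^{Stab(x_X)}` and `Stab(x_Y)` is the fixing group
  of its fixed field);
* `galoisFields_essSurj` — ESSENTIALLY SURJECTIVE: a finite separable `K/F` embeds into `F̄` with image
  `K'`; `G_F/Gal(F̄/K')` is a (finite, hence countable) transitive continuous `G_F`-set — an object of
  `B^temp(G_F)⁰` (`G_F` is profinite, hence tempered, [SemiAnbd] Rmk 3.1.1) — whose field is a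
  `Gal(F̄/F)`-translate of `K' ≅ K`;
* `isEquivalence_galoisFields` — hence `galoisFields F` is an equivalence `B^temp(G_F)⁰ ≃ D₀ = FinEtale F`.

Classical Galois theory over Mathlib; no statement of the paper is strengthened; nothing here bears on
[IUTchIII].
-/

namespace Literature.AlgebraicGeometry.Frobenioids

namespace QuasiTemperoid

open CategoryTheory Topology
open Literature.AnabelianGeometry.SemiGraphs

universe u

variable (F : Type u) [Field F]

/-! ### Fullness -/

/-- Descent criterion used for fullness: if `σ ∈ Gal(F̄/F)` maps `F̄^{Stab(x_Y)}` into `F̄^{Stab(x_X)}`,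
then `Stab(x_X)` fixes `σ·x_Y`. [cite: MochizukiFrdII2008, Ex 1.3 (iii) pp.11-12] -/
theorem ρ_apply_carrier_eq_of_maps_fixFld [PerfectField F] {X Y : ConnectedPart (BTemp (GalFbar F))}
    (σ : GalFbar F) (hσ : ∀ a ∈ fixFld F Y, σ a ∈ fixFld F X)
    (g : GalFbar F) (hg : X.obj.obj.ρ g (basePt X) = basePt X) :
    Y.obj.obj.ρ g (Y.obj.obj.ρ σ (basePt Y)) = Y.obj.obj.ρ σ (basePt Y) := by
  -- `σ⁻¹ g σ` fixes `F̄^{Stab(x_Y)}` pointwise, hence lies in `Stab(x_Y)`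
  have hmem : σ⁻¹ * g * σ ∈ (fixFld F Y).fixingSubgroup := by
    rw [IntermediateField.mem_fixingSubgroup_iff]
    intro a ha
    have hfix : g (σ a) = σ a :=
      ((mem_fixFld_iff F X (σ a)).mp (hσ a ha)) g hg
    rw [AlgEquiv.mul_apply, AlgEquiv.mul_apply, hfix, AlgEquiv.aut_inv, AlgEquiv.symm_apply_apply]
  rw [fixingSubgroup_fixFld, mem_stabilizerSubgroup_iff, BTempConnected.ρ_mul_apply,
    BTempConnected.ρ_mul_apply] at hmem
  -- apply `σ` to both sides of `σ⁻¹ · g · σ · x_Y = x_Y`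
  have := congrArg (Y.obj.obj.ρ σ) hmem
  rwa [BTempConnected.ρ_apply_inv] at this

/-- **`galoisFields F` is FULL** ("[cf. Example 1.1, (ii)]": every morphism `Spec F̄^{Stab(x_X)} → Spec F̄^{Stab(x_Y)}`
of `D₀` comes from a `G_F`-map `X → Y`). [cite: MochizukiFrdII2008, Ex 1.3 (iii) pp.11-12] -/
theorem galoisFields_full [PerfectField F] : (galoisFields F).Full := by
  refine ⟨fun {X Y} φ => ?_⟩
  -- the field map, seen on the intermediate fields themselves
  let ψ : fixFld F Y →ₐ[F] fixFld F X := φ.alg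
  -- extend `ψ : F̄^{Stab x_Y} → F̄^{Stab x_X}` to an automorphism `σ` of `F̄`
  let σ₀ : Fbar F →ₐ[F] Fbar F := ψ.liftNormal (Fbar F)
  let σ : GalFbar F := AlgEquiv.ofBijective σ₀ (Algebra.IsAlgebraic.algHom_bijective σ₀)
  have hσa : ∀ a : fixFld F Y, σ (a : Fbar F) = ((ψ a : fixFld F X) : Fbar F) := fun a =>
    ψ.liftNormal_commutes (Fbar F) a
  have hσ : ∀ a ∈ fixFld F Y, σ a ∈ fixFld F X := fun a ha => by
    rw [hσa ⟨a, ha⟩]; exact Subtype.mem _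
  -- the `G_F`-map `x_X ↦ σ · x_Y`
  obtain ⟨f₀, hf₀⟩ := BTempConnected.exists_hom_of_stabilizer_le (T₁ := X.obj) (T₂ := Y.obj) (basePt X)
    (BTempConnected.exists_ρ_eq_of_isConnectedObj X.obj X.property (basePt X))
    (Y.obj.obj.ρ σ (basePt Y)) (ρ_apply_carrier_eq_of_maps_fixFld F σ hσ)
  refine ⟨ObjectProperty.homMk f₀, ?_⟩
  apply FinEtale.hom_ext
  change fieldMap (ObjectProperty.homMk f₀ : X ⟶ Y) = ψ
  apply AlgHom.ext
  intro a
  apply Subtype.ext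
  rw [fieldMap_apply_of_ρ_eq (F := F) (ObjectProperty.homMk f₀ : X ⟶ Y) (g := σ) hf₀.symm a, hσa]

/-! ### Essential surjectivity -/

/-- `Gal(F̄/F)` is tempered (profinite ⇒ tempered, [SemiAnbd] Rmk 3.1.1; compact by Mathlib's Krull-topology
profiniteness for the Galois extension `F̄/F`, `F` perfect). [cite: MochizukiFrdII2008, Ex 1.3 (i) p.11] -/
theorem isTempered_galFbar [PerfectField F] : IsTempered (GalFbar F) := by
  haveI : IsGalois F (Fbar F) := {}
  exact IsTempered.of_profinite

/-- For `τ ∈ Gal(F̄/F)` and a subgroup `H`: `a` is fixed by `τHτ⁻¹` iff `τ⁻¹ a` is fixed by `H`.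
[cite: MochizukiFrdII2008, Ex 1.3 (iii) pp.11-12] -/
theorem mem_fixedField_map_conj_iff (H : Subgroup (GalFbar F)) (τ : GalFbar F) (a : Fbar F) :
    a ∈ IntermediateField.fixedField (H.map (MulAut.conj τ).toMonoidHom) ↔
      τ.symm a ∈ IntermediateField.fixedField H := by
  rw [IntermediateField.mem_fixedField_iff, IntermediateField.mem_fixedField_iff]
  constructor
  · intro hyp h hh
    have h1 := hyp ((MulAut.conj τ).toMonoidHom h) (Subgroup.mem_map_of_mem _ hh)
    rw [MulEquiv.coe_toMonoidHom, MulAut.conj_apply, AlgEquiv.mul_apply, AlgEquiv.mul_apply,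
      AlgEquiv.aut_inv] at h1
    simpa using congrArg τ.symm h1
  · intro hyp f hf
    obtain ⟨h, hh, rfl⟩ := Subgroup.mem_map.mp hf
    rw [MulEquiv.coe_toMonoidHom, MulAut.conj_apply, AlgEquiv.mul_apply, AlgEquiv.mul_apply,
      AlgEquiv.aut_inv, hyp h hh, AlgEquiv.apply_symm_apply]

/-- **`galoisFields F` is ESSENTIALLY SURJECTIVE**: every connected finite étale covering `Spec K → Spec F`
(`K/F` finite separable) is `Spec F̄^{Stab(x)}` for a connected `G_F`-set, namely `G_F / Gal(F̄/K')` for an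
embedding `K ≅ K' ⊆ F̄`. [cite: MochizukiFrdII2008, Ex 1.3 (iii) pp.11-12] -/
theorem galoisFields_essSurj [PerfectField F] : (galoisFields F).EssSurj := by
  haveI : IsGalois F (Fbar F) := {}
  refine ⟨fun K => ?_⟩
  -- embed `K` into `F̄`; `K' := ι(K)`
  let ι : K →ₐ[F] Fbar F := IsAlgClosed.lift (M := Fbar F)
  haveI : FiniteDimensional F (⊤ : IntermediateField F K) :=
    LinearEquiv.finiteDimensional (IntermediateField.topEquiv (F := F) (E := K)).symm.toLinearEquiv
  let K' : IntermediateField F (Fbar F) := (⊤ : IntermediateField F K).map ι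
  let e₁ : K ≃ₐ[F] K' := (IntermediateField.topEquiv (F := F) (E := K)).symm.trans
    ((⊤ : IntermediateField F K).equivMap ι)
  haveI hK' : FiniteDimensional F K' := LinearEquiv.finiteDimensional e₁.toLinearEquiv
  -- `H := Gal(F̄/K')`, open; the `G_F`-set `G_F/H`
  let H : Subgroup (GalFbar F) := K'.fixingSubgroup
  have hH : IsOpen (H : Set (GalFbar F)) := (InfiniteGalois.isOpen_iff_finite K').mpr hK'
  let T : BTemp (GalFbar F) := cosetObj (GalFbar F) (isTempered_galFbar F) H hH
  have hρ : ∀ (g : GalFbar F) (c : GalFbar F ⧸ H), (T.obj.ρ g c : GalFbar F ⧸ H) = g • c := fun _ _ => rfl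
  have htr : ∀ c : T.obj.V, ∃ g : GalFbar F, T.obj.ρ g ((1 : GalFbar F) : GalFbar F ⧸ H) = c := by
    intro c
    obtain ⟨g, rfl⟩ := QuotientGroup.mk_surjective c
    exact ⟨g, by rw [hρ, MulAction.Quotient.smul_coe, smul_eq_mul, mul_one]⟩
  let X : ConnectedPart (BTemp (GalFbar F)) := ⟨T, BTempConnected.isConnectedObj_of_transitive T _ htr⟩
  -- its base point is some coset `τH`; its stabiliser is `τHτ⁻¹`
  obtain ⟨τ, hτ⟩ := QuotientGroup.mk_surjective (basePt X)
  have hstab : stabilizerSubgroup X.obj (basePt X) = H.map (MulAut.conj τ).toMonoidHom := by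
    ext g
    rw [mem_stabilizerSubgroup_iff]
    change g • (show GalFbar F ⧸ H from basePt X) = (show GalFbar F ⧸ H from basePt X) ↔ _
    rw [← hτ, ← MulAction.mem_stabilizer_iff]
    have hτ1 : ((τ : GalFbar F) : GalFbar F ⧸ H) = τ • ((1 : GalFbar F) : GalFbar F ⧸ H) := by
      rw [MulAction.Quotient.smul_coe, smul_eq_mul, mul_one]
    rw [hτ1, MulAction.stabilizer_smul_eq_stabilizer_map_conj, MulAction.stabilizer_quotient]
  -- the field of `X` is `τ(K')`; build `K' ≃ₐ[F] F̄^{Stab(x_X)}` by `a ↦ τ a`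
  have hfwd : ∀ a ∈ K', τ a ∈ fixFld F X := by
    intro a ha
    rw [fixFld, hstab, mem_fixedField_map_conj_iff, AlgEquiv.symm_apply_apply,
      InfiniteGalois.fixedField_fixingSubgroup]
    exact ha
  have hbwd : ∀ a ∈ fixFld F X, τ.symm a ∈ K' := by
    intro a ha
    rw [fixFld, hstab, mem_fixedField_map_conj_iff, InfiniteGalois.fixedField_fixingSubgroup] at ha
    exact ha
  let fwd : K' →ₐ[F] fixFld F X := restrictBetween τ K' (fixFld F X) hfwd
  let bwd : fixFld F X →ₐ[F] K' := restrictBetween τ.symm (fixFld F X) K' hbwd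
  let e₂ : K' ≃ₐ[F] fixFld F X := AlgEquiv.ofAlgHom fwd bwd
    (AlgHom.ext fun a => Subtype.ext (τ.apply_symm_apply (a : Fbar F)))
    (AlgHom.ext fun a => Subtype.ext (τ.symm_apply_apply (a : Fbar F)))
  let e : K ≃ₐ[F] fixFld F X := e₁.trans e₂
  -- the isomorphism `galoisFields X ≅ Spec K` in `D₀`
  refine ⟨X, ⟨{ hom := ⟨e.toAlgHom⟩, inv := ⟨e.symm.toAlgHom⟩, hom_inv_id := ?_, inv_hom_id := ?_ }⟩⟩
  · exact FinEtale.hom_ext (AlgHom.ext fun a => e.apply_symm_apply a)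
  · exact FinEtale.hom_ext (AlgHom.ext fun a => e.symm_apply_apply a)

/-- **FrdII Example 1.3 (iii) "[cf. Example 1.1, (ii)]": `galoisFields F : B^temp(G_F)⁰ ⥤ D₀ = FinEtale F` is an
EQUIVALENCE of categories** (faithful — `galoisFields_faithful`; full; essentially surjective).
[cite: MochizukiFrdII2008, Ex 1.3 (iii) pp.11-12] -/
theorem isEquivalence_galoisFields [PerfectField F] : (galoisFields F).IsEquivalence :=
  haveI := galoisFields_faithful F
  haveI := galoisFields_full F
  haveI := galoisFields_essSurj F
  {}

end QuasiTemperoid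

end Literature.AlgebraicGeometry.Frobenioids
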